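import Literature.Analysis.FluidPDE.ConstantinSmallViscositySlice
import HarnessLib

/-!
# Constantin's small-viscosity comparison theorem: the slice inequality for a word in energy
# form (Sobolev imbedding of the trilinear terms)

Analysis/FluidPDE support file (theorems only, no definitions, no named facts) on the discharge
path of `Literature.Analysis.FluidPDE.constantin_small_viscosity` (`ConstantinSmallViscosity.lean`;
P. Constantin, Comm. Math. Phys. 104 (1986), 311–326, §1, Thm. 1.1). It continues the tree's
`ConstantinSmallViscositySlice.lean` (`constantin_slice_word_pairing_le`: Constantin's `H^m`
energy inequality (1.10) for the difference `w = a − b` of a Navier–Stokes and an Euler slice,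
localised with a weight `χ` and stated for a fixed word `α`, with the trilinear terms
`∫ χ |∇ᶜwⱼ| |∇^{n−c+1}wᵢ| |∂^α wᵢ|` kept) in dimension three:

* `exists_dnormSq_le_energy` — the Sobolev imbedding `H² ⊂ L^∞` in energy form: for a level
  `k` there is `C` with `|∇ᶜwᵢ(x)|² ≤ C E` whenever `c + 2 ≤ k` and the level integrals
  `∫∑ᵢ|∇ᵐwᵢ|²`, `m ≤ k`, are `≤ E` (from the tree's `exists_abs_le_sobolev_dnormSq`, Adams 1975,
  Thm. 5.4);
* `trilinear_le_energy` — for `k ≥ 4`, `n ≤ k`, in every product `|∇ᶜwⱼ| |∇^{n−c+1}wᵢ|`,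
  `1 ≤ c ≤ n`, one factor has at most `k − 2` derivatives, so the trilinear terms are
  `≤ 2ⁿ 9 n √C E √E` (this replaces Constantin's use of Kato's sharp commutator estimates (1.8) at
  level `m ≥ 3` by a cruder bound at level `k = m + 1 ≥ 4`);
* `sqrt_integral_sq_sum_dnorm_ipderiv_le` — the pressure cut-off error term of the slice
  inequality is controlled by level integrals up to order `2n`;
* `slice_word_le_energy_form` — the slice inequality for a word with right-hand side
  `X A_χ/R + ν 9 √I_U √E + 2ⁿ 9 B_b (n+1)² E + 2ⁿ 9 n √C E√E`, `E` the energy at level `k`,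
  `X` built from bounds valid on the whole slab (the shape integrated in time by
  `ConstantinDifferenceEnergy.energy_le_of_slice`).

## Mathlib / tree search

Tree (used): `constantin_slice_word_pairing_le`, `constantin_integrable_dnormSq_of_sum`,
`constantin_memLp_ipderiv_and_le`, `constantin_memLp_dnorm_and_le`
(`ConstantinSmallViscositySlice`), `exists_abs_le_sobolev_dnormSq`, `integral_le_of_abs_le_mul_mul`,
`integrable_dnormSq_ipderiv`, `dnormSq_ipderiv_le` (`ConstantinSmallViscosityCalculus`),
`dnorm_sq`, `dnormSq` (`CoordDerivatives`). Mathlib: `sq_sum_le_card_mul_sum_sq`.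

## References

* P. Constantin, Comm. Math. Phys. 104 (1986), 311–326, §1, (1.8)–(1.10). [Constantin1986]
* R. A. Adams, *Sobolev Spaces* (1975), Thm. 5.4. [Adams1975]
-/

noncomputable section

open MeasureTheory Set Function Filter
open scoped ENNReal NNReal ContDiff BigOperators

namespace Literature.Analysis.FluidPDE

/-! ## The Sobolev imbedding in energy form -/

section Sobolev

/-- **`H² ⊂ L^∞` in energy form.** For every `k` there is `C ≥ 0` such that: if `w₀, w₁, w₂` are
smooth scalar fields on `ℝ³` whose level integrals `∫∑ᵢ|∇ᵐwᵢ|²`, `m ≤ k`, are all `≤ E`, then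
`|∇ᶜwᵢ(x)|² ≤ C E` for every `c` with `c + 2 ≤ k` (apply the tree's coordinate Sobolev bound
`exists_abs_le_sobolev_dnormSq` to each `∂^β wᵢ`, `|β| = c`, whose Sobolev data of orders `≤ 2` are
level integrals of orders `c, c+1, c+2 ≤ k`). [cite: Adams1975, Thm. 5.4 Part I Case C (mp > n)] -/
theorem exists_dnormSq_le_energy (k : ℕ) :
    ∃ C : ℝ, 0 ≤ C ∧ ∀ (w : Fin 3 → EuclideanSpace ℝ (Fin 3) → ℝ), (∀ i, ContDiff ℝ ∞ (w i)) →
      ∀ E : ℝ, 0 ≤ E →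
        (∀ m ≤ k, Integrable (fun x => ∑ i, dnormSq m (w i) x) ∧ ∫ x, ∑ i, dnormSq m (w i) x ≤ E) →
        ∀ c : ℕ, c + 2 ≤ k → ∀ (i : Fin 3) (x : EuclideanSpace ℝ (Fin 3)), dnormSq c (w i) x ≤ C * E := by
  obtain ⟨K, hK0, hK⟩ := exists_abs_le_sobolev_dnormSq
  refine ⟨3 ^ k * (3 * K) ^ 2, by positivity, fun w hw E hE hEle c hc i x => ?_⟩
  have key : ∀ β : Fin c → Fin 3, |ipderiv β (w i) x| ≤ 3 * K * Real.sqrt E := by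
    intro β
    have hf : ContDiff ℝ ∞ (ipderiv β (w i)) := contDiff_ipderiv (hw i) β
    have hjint : ∀ j ∈ Finset.range 3, Integrable (dnormSq j (ipderiv β (w i))) ∧
        ∫ y, dnormSq j (ipderiv β (w i)) y ≤ E := by
      intro j hj
      have hj2 : j ≤ 2 := Nat.lt_succ_iff.1 (Finset.mem_range.1 hj)
      have hm : j + c ≤ k := by omega
      obtain ⟨hIi, hle⟩ := constantin_integrable_dnormSq_of_sum hw (j + c) (hEle (j + c) hm).1 i
      have hint : Integrable (dnormSq j (ipderiv β (w i))) := integrable_dnormSq_ipderiv (hw i) j β hIi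
      refine ⟨hint, ?_⟩
      calc ∫ y, dnormSq j (ipderiv β (w i)) y ≤ ∫ y, dnormSq (j + c) (w i) y :=
            integral_mono hint hIi fun y => dnormSq_ipderiv_le (hw i) j β y
        _ ≤ ∫ y, ∑ i', dnormSq (j + c) (w i') y := hle
        _ ≤ E := (hEle (j + c) hm).2
    calc |ipderiv β (w i) x| ≤ K * ∑ j ∈ Finset.range 3, Real.sqrt (∫ y, dnormSq j (ipderiv β (w i)) y) :=
          hK _ hf (fun j hj => (hjint j hj).1) x
      _ ≤ K * ∑ _j ∈ Finset.range 3, Real.sqrt E := by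
          refine mul_le_mul_of_nonneg_left (Finset.sum_le_sum fun j hj => ?_) hK0
          exact Real.sqrt_le_sqrt (hjint j hj).2
      _ = 3 * K * Real.sqrt E := by
          rw [Finset.sum_const, Finset.card_range, nsmul_eq_mul]
          push_cast
          ring
  have hsq : ∀ β : Fin c → Fin 3, ipderiv β (w i) x ^ 2 ≤ (3 * K) ^ 2 * E := fun β => by
    have h1 : |ipderiv β (w i) x| ^ 2 ≤ (3 * K * Real.sqrt E) ^ 2 :=
      pow_le_pow_left₀ (abs_nonneg _) (key β) 2
    rw [sq_abs, mul_pow, Real.sq_sqrt hE] at h1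
    exact h1
  calc dnormSq c (w i) x = ∑ β : Fin c → Fin 3, ipderiv β (w i) x ^ 2 := rfl
    _ ≤ ∑ _β : Fin c → Fin 3, (3 * K) ^ 2 * E := Finset.sum_le_sum fun β _ => hsq β
    _ = 3 ^ c * ((3 * K) ^ 2 * E) := by
        rw [Finset.sum_const, Finset.card_univ, Fintype.card_fun, Fintype.card_fin, Fintype.card_fin,
          nsmul_eq_mul]
        push_cast
        ring
    _ ≤ 3 ^ k * ((3 * K) ^ 2 * E) := by
        refine mul_le_mul_of_nonneg_right (pow_le_pow_right₀ (by norm_num) (by omega)) (by positivity)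
    _ = 3 ^ k * (3 * K) ^ 2 * E := by ring

end Sobolev

/-! ## The trilinear terms -/

section Trilinear

/-- **The trilinear terms in energy form.** For `k ≥ 4`, `n ≤ k`, a word `α` of length `n`,
smooth `w₀, w₁, w₂` with level integrals `∫∑ᵢ|∇ᵐwᵢ|² ≤ E` (`m ≤ k`) and the sup bound
`|∇ᶜwᵢ|² ≤ C E` for `c + 2 ≤ k`, and a weight `0 ≤ χ ≤ 1`:
`2ⁿ ∑ᵢ∑ⱼ∑_{c=1}^{n} ∫ χ |∇ᶜwⱼ| |∇^{n−c+1}wᵢ| |∂^α wᵢ| ≤ 2ⁿ 9 n √C E√E`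
(in each product one of `c`, `n − c + 1` is `≤ k − 2`; that factor is bounded pointwise by
`√(CE)`, the other two are in `L²` with norms `≤ √E`). [folklore] -/
theorem trilinear_le_energy {w : Fin 3 → EuclideanSpace ℝ (Fin 3) → ℝ} (hw : ∀ i, ContDiff ℝ ∞ (w i))
    {k n : ℕ} (hk : 4 ≤ k) (hn : n ≤ k) (α : Fin n → Fin 3) {E C : ℝ} (hE : 0 ≤ E) (hC : 0 ≤ C)
    (hEle : ∀ m ≤ k, Integrable (fun x => ∑ i, dnormSq m (w i) x) ∧ ∫ x, ∑ i, dnormSq m (w i) x ≤ E)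
    (hsup : ∀ c : ℕ, c + 2 ≤ k → ∀ (i : Fin 3) (x : EuclideanSpace ℝ (Fin 3)), dnormSq c (w i) x ≤ C * E)
    {χ : EuclideanSpace ℝ (Fin 3) → ℝ} (hχ0 : ∀ x, 0 ≤ χ x) (hχ1 : ∀ x, χ x ≤ 1) :
    2 ^ n * ∑ i, ∑ j, ∑ c ∈ Finset.Icc 1 n,
        ∫ x, χ x * (dnorm c (w j) x * (dnorm (n - c + 1) (w i) x * |ipderiv α (w i) x|)) ≤
      2 ^ n * (9 * n * (Real.sqrt C * (E * Real.sqrt E))) := by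
  refine mul_le_mul_of_nonneg_left ?_ (by positivity)
  -- `L²` sizes
  have hL2dnorm : ∀ m ≤ k, ∀ i, MemLp (dnorm m (w i)) 2 volume ∧
      Real.sqrt (∫ x, dnorm m (w i) x ^ 2) ≤ Real.sqrt E := fun m hm i => by
    obtain ⟨hmem, hle⟩ := constantin_memLp_dnorm_and_le hw m (hEle m hm).1 i
    exact ⟨hmem, hle.trans (Real.sqrt_le_sqrt (hEle m hm).2)⟩
  have hL2G : ∀ i, MemLp (ipderiv α (w i)) 2 volume ∧
      Real.sqrt (∫ x, ipderiv α (w i) x ^ 2) ≤ Real.sqrt E := fun i => by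
    obtain ⟨hmem, hle⟩ := constantin_memLp_ipderiv_and_le hw (hEle n hn).1 α i
    exact ⟨hmem, hle.trans (Real.sqrt_le_sqrt (hEle n hn).2)⟩
  -- the sup bound as a bound of `dnorm`
  have hsup' : ∀ c : ℕ, c + 2 ≤ k → ∀ (i : Fin 3) (x : EuclideanSpace ℝ (Fin 3)),
      |dnorm c (w i) x| ≤ Real.sqrt (C * E) := fun c hc i x => by
    rw [abs_of_nonneg (dnorm_nonneg _ _ _), dnorm]
    exact Real.sqrt_le_sqrt (hsup c hc i x)
  have hCE : Real.sqrt (C * E) * (Real.sqrt E * Real.sqrt E) = Real.sqrt C * (E * Real.sqrt E) := by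
    rw [Real.sqrt_mul hC, Real.mul_self_sqrt hE]
    ring
  -- each term
  have hterm : ∀ (i j : Fin 3), ∀ c ∈ Finset.Icc 1 n,
      ∫ x, χ x * (dnorm c (w j) x * (dnorm (n - c + 1) (w i) x * |ipderiv α (w i) x|)) ≤
        Real.sqrt C * (E * Real.sqrt E) := by
    intro i j c hc
    rw [Finset.mem_Icc] at hc
    have hc' : n - c + 1 ≤ k := by omega
    have habsF : ∀ x, |χ x * (dnorm c (w j) x * (dnorm (n - c + 1) (w i) x * |ipderiv α (w i) x|))| =
        χ x * (dnorm c (w j) x * (dnorm (n - c + 1) (w i) x * |ipderiv α (w i) x|)) := fun x =>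
      abs_of_nonneg (mul_nonneg (hχ0 x) (mul_nonneg (dnorm_nonneg _ _ _)
        (mul_nonneg (dnorm_nonneg _ _ _) (abs_nonneg _))))
    by_cases hcase : c + 2 ≤ k
    · -- the factor `|∇ᶜwⱼ|` is bounded
      have h := integral_le_of_abs_le_mul_mul (μ := volume)
        (F := fun x => χ x * (dnorm c (w j) x * (dnorm (n - c + 1) (w i) x * |ipderiv α (w i) x|)))
        (h := dnorm c (w j)) (f := dnorm (n - c + 1) (w i)) (g := ipderiv α (w i))
        (hL2dnorm _ hc' i).1 (hL2G i).1 zero_le_one (Real.sqrt_nonneg _) (hsup' c hcase j) fun x => by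
          rw [habsF x, one_mul, abs_of_nonneg (dnorm_nonneg _ _ _), abs_of_nonneg (dnorm_nonneg _ _ _)]
          exact mul_le_of_le_one_left (mul_nonneg (dnorm_nonneg _ _ _)
            (mul_nonneg (dnorm_nonneg _ _ _) (abs_nonneg _))) (hχ1 x)
      refine h.trans ?_
      rw [one_mul, ← hCE]
      exact mul_le_mul_of_nonneg_left (mul_le_mul (hL2dnorm _ hc' i).2 (hL2G i).2
        (Real.sqrt_nonneg _) (Real.sqrt_nonneg _)) (Real.sqrt_nonneg _)
    · -- the factor `|∇^{n-c+1}wᵢ|` is bounded (`n - c + 1 ≤ 2`, `k ≥ 4`)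
      have hc2 : n - c + 1 + 2 ≤ k := by omega
      have h := integral_le_of_abs_le_mul_mul (μ := volume)
        (F := fun x => χ x * (dnorm c (w j) x * (dnorm (n - c + 1) (w i) x * |ipderiv α (w i) x|)))
        (h := dnorm (n - c + 1) (w i)) (f := dnorm c (w j)) (g := ipderiv α (w i))
        (hL2dnorm c (by omega) j).1 (hL2G i).1 zero_le_one (Real.sqrt_nonneg _) (hsup' _ hc2 i)
        fun x => by
          rw [habsF x, one_mul, abs_of_nonneg (dnorm_nonneg _ _ _), abs_of_nonneg (dnorm_nonneg _ _ _)]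
          calc χ x * (dnorm c (w j) x * (dnorm (n - c + 1) (w i) x * |ipderiv α (w i) x|))
              ≤ 1 * (dnorm c (w j) x * (dnorm (n - c + 1) (w i) x * |ipderiv α (w i) x|)) :=
                mul_le_mul_of_nonneg_right (hχ1 x) (mul_nonneg (dnorm_nonneg _ _ _)
                  (mul_nonneg (dnorm_nonneg _ _ _) (abs_nonneg _)))
            _ = dnorm (n - c + 1) (w i) x * (dnorm c (w j) x * |ipderiv α (w i) x|) := by ring
      refine h.trans ?_
      rw [one_mul, ← hCE]
      exact mul_le_mul_of_nonneg_left (mul_le_mul (hL2dnorm c (by omega) j).2 (hL2G i).2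
        (Real.sqrt_nonneg _) (Real.sqrt_nonneg _)) (Real.sqrt_nonneg _)
  calc ∑ i, ∑ j, ∑ c ∈ Finset.Icc 1 n,
        ∫ x, χ x * (dnorm c (w j) x * (dnorm (n - c + 1) (w i) x * |ipderiv α (w i) x|))
      ≤ ∑ _i : Fin 3, ∑ _j : Fin 3, ∑ _c ∈ Finset.Icc 1 n, Real.sqrt C * (E * Real.sqrt E) :=
        Finset.sum_le_sum fun i _ => Finset.sum_le_sum fun j _ => Finset.sum_le_sum fun c hc =>
          hterm i j c hc
    _ = 9 * n * (Real.sqrt C * (E * Real.sqrt E)) := by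
        rw [Finset.sum_const, Finset.sum_const, Finset.sum_const, Finset.card_univ, Fintype.card_fin,
          Nat.card_Icc, nsmul_eq_mul, nsmul_eq_mul, nsmul_eq_mul]
        push_cast
        ring

end Trilinear

/-! ## The pressure cut-off error term -/

section PressureError

/-- **The pressure cut-off error term in terms of level integrals**: for smooth `w₀, w₁, w₂` all
of whose level integrals up to order `2n` are `≤ I`,
`(∫ (∑ᵢ ∑_{k' ≤ n} |∇^{n−k'} ∂^α wᵢ|)²)^{1/2} ≤ 3 (n + 1) √I` (Cauchy–Schwarz for the finite sum and
`|∇ᵐ∂^α wᵢ|² ≤ |∇^{m+n} wᵢ|²`). [folklore] -/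
theorem sqrt_integral_sq_sum_dnorm_ipderiv_le {w : Fin 3 → EuclideanSpace ℝ (Fin 3) → ℝ}
    (hw : ∀ i, ContDiff ℝ ∞ (w i)) {n : ℕ} (α : Fin n → Fin 3) {I : ℝ}
    (hIall : ∀ m, Integrable (fun x => ∑ i, dnormSq m (w i) x))
    (hI : ∀ m ≤ 2 * n, ∫ x, ∑ i, dnormSq m (w i) x ≤ I) :
    Real.sqrt (∫ x, (∑ i, ∑ k' ∈ Finset.range (n + 1), dnorm (n - k') (ipderiv α (w i)) x) ^ 2) ≤
      3 * (n + 1) * Real.sqrt I := by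
  -- the squares of the summands and their integrals
  have hf2 : ∀ (i : Fin 3), ∀ k' ∈ Finset.range (n + 1),
      Integrable (fun x => dnorm (n - k') (ipderiv α (w i)) x ^ 2) ∧
        ∫ x, dnorm (n - k') (ipderiv α (w i)) x ^ 2 ≤ I := by
    intro i k' hk'
    have hm : n - k' + n ≤ 2 * n := by omega
    obtain ⟨hIi, hle⟩ := constantin_integrable_dnormSq_of_sum hw (n - k' + n) (hIall _) i
    have hint : Integrable (dnormSq (n - k') (ipderiv α (w i))) := integrable_dnormSq_ipderiv (hw i) _ α hIi
    have e : (fun x => dnorm (n - k') (ipderiv α (w i)) x ^ 2) = dnormSq (n - k') (ipderiv α (w i)) :=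
      funext fun x => dnorm_sq _ _ x
    rw [e]
    refine ⟨hint, ?_⟩
    calc ∫ x, dnormSq (n - k') (ipderiv α (w i)) x ≤ ∫ x, dnormSq (n - k' + n) (w i) x :=
          integral_mono hint hIi fun x => dnormSq_ipderiv_le (hw i) _ α x
      _ ≤ ∫ x, ∑ j, dnormSq (n - k' + n) (w j) x := hle
      _ ≤ I := hI _ hm
  -- pointwise Cauchy–Schwarz
  have hpt : ∀ x, (∑ i, ∑ k' ∈ Finset.range (n + 1), dnorm (n - k') (ipderiv α (w i)) x) ^ 2 ≤
      3 * ((n + 1) * ∑ i, ∑ k' ∈ Finset.range (n + 1), dnorm (n - k') (ipderiv α (w i)) x ^ 2) := by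
    intro x
    have h1 := sq_sum_le_card_mul_sum_sq (s := (Finset.univ : Finset (Fin 3)))
      (f := fun i => ∑ k' ∈ Finset.range (n + 1), dnorm (n - k') (ipderiv α (w i)) x)
    have h2 : ∀ i : Fin 3, (∑ k' ∈ Finset.range (n + 1), dnorm (n - k') (ipderiv α (w i)) x) ^ 2 ≤
        (n + 1) * ∑ k' ∈ Finset.range (n + 1), dnorm (n - k') (ipderiv α (w i)) x ^ 2 := fun i => by
      have := sq_sum_le_card_mul_sum_sq (s := Finset.range (n + 1))
        (f := fun k' => dnorm (n - k') (ipderiv α (w i)) x)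
      rw [Finset.card_range] at this
      push_cast at this
      exact this
    rw [Finset.card_univ, Fintype.card_fin] at h1
    push_cast at h1
    refine h1.trans (mul_le_mul_of_nonneg_left ?_ (by norm_num))
    calc ∑ i, (∑ k' ∈ Finset.range (n + 1), dnorm (n - k') (ipderiv α (w i)) x) ^ 2
        ≤ ∑ i, ((n + 1) * ∑ k' ∈ Finset.range (n + 1), dnorm (n - k') (ipderiv α (w i)) x ^ 2) :=
          Finset.sum_le_sum fun i _ => h2 i
      _ = (n + 1) * ∑ i, ∑ k' ∈ Finset.range (n + 1), dnorm (n - k') (ipderiv α (w i)) x ^ 2 := by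
          rw [Finset.mul_sum]
  have hdom : Integrable fun x => 3 * ((n + 1) *
      ∑ i, ∑ k' ∈ Finset.range (n + 1), dnorm (n - k') (ipderiv α (w i)) x ^ 2) :=
    ((integrable_finsetSum _ fun i _ => integrable_finsetSum _ fun k' hk' => (hf2 i k' hk').1).const_mul _).const_mul _
  have hint : ∫ x, (∑ i, ∑ k' ∈ Finset.range (n + 1), dnorm (n - k') (ipderiv α (w i)) x) ^ 2 ≤
      3 * ((n + 1) * (3 * ((n + 1) * I))) := by
    calc ∫ x, (∑ i, ∑ k' ∈ Finset.range (n + 1), dnorm (n - k') (ipderiv α (w i)) x) ^ 2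
        ≤ ∫ x, 3 * ((n + 1) * ∑ i, ∑ k' ∈ Finset.range (n + 1), dnorm (n - k') (ipderiv α (w i)) x ^ 2) :=
          integral_mono_of_nonneg (Eventually.of_forall fun x => sq_nonneg _) hdom (Eventually.of_forall hpt)
      _ = 3 * ((n + 1) * ∑ i, ∑ k' ∈ Finset.range (n + 1), ∫ x, dnorm (n - k') (ipderiv α (w i)) x ^ 2) := by
          rw [integral_const_mul, integral_const_mul,
            integral_finsetSum _ fun i _ => integrable_finsetSum _ fun k' hk' => (hf2 i k' hk').1]
          congr 2
          exact Finset.sum_congr rfl fun i _ => integral_finsetSum _ fun k' hk' => (hf2 i k' hk').1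
      _ ≤ 3 * ((n + 1) * ∑ _i : Fin 3, ∑ _k' ∈ Finset.range (n + 1), I) := by
          gcongr with i _ k' hk'
          exact (hf2 i k' hk').2
      _ = 3 * ((n + 1) * (3 * ((n + 1) * I))) := by
          rw [Finset.sum_const, Finset.sum_const, Finset.card_univ, Fintype.card_fin, Finset.card_range,
            nsmul_eq_mul, nsmul_eq_mul]
          push_cast
          ring
  calc Real.sqrt (∫ x, (∑ i, ∑ k' ∈ Finset.range (n + 1), dnorm (n - k') (ipderiv α (w i)) x) ^ 2)
      ≤ Real.sqrt (3 * ((n + 1) * (3 * ((n + 1) * I)))) := Real.sqrt_le_sqrt hint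
    _ = Real.sqrt ((3 * (n + 1)) ^ 2 * I) := by ring_nf
    _ = 3 * (n + 1) * Real.sqrt I := by
        rw [Real.sqrt_mul (by positivity), Real.sqrt_sq (by positivity)]

end PressureError

/-! ## The slice inequality for a word in energy form -/

section Word

/-- **The slice inequality for a fixed word in energy form** (Constantin 1986, (1.10) localised,
before time integration). In the setting of `constantin_slice_word_pairing_le` on `ℝ³` — smooth
divergence-free `a` (Navier–Stokes slice), `b` (Euler slice), pressures with
`p₁ − p₂ = Q + c₀`, `‖Q‖₂ ≤ Q_*`, `w = a − b`, a weight `χ` (later `χ_R`) with `0 ≤ χ ≤ 1` and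
all derivatives of orders `1, …, n + 1` bounded by `A_χ/R`, `R ≥ 1` — assume `k ≥ 4`, `n ≤ k`,
that the level integrals `∫∑ᵢ|∇ᵐwᵢ|²` are `≤ E` for `m ≤ k` and `≤ I_w` for `m ≤ 2k + 1`, the sup
bound `|∇ᶜwᵢ|² ≤ C E` (`c + 2 ≤ k`), `|aⱼ| ≤ B_a`, `|∇ᶜbᵢ| ≤ B_b` (`c ≤ n + 1`) and
`∫∑ᵢ|∇^{n+2}bᵢ|² ≤ I_U`. Then
`∑ᵢ ∫ χ (∂^α RHSᵢ(a, p₁) − ∂^α RHSᵢ(b, p₂)) ∂^α wᵢ ≤ A_χ X / R + ν 9 √I_U √E + 2ⁿ 9 B_b (n+1)² E + 2ⁿ 9 n √C E √E`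
with `X = 9 B_a I_w / 2 + 9 ν I_w + 2ⁿ Q_* 3 (n + 1) √I_w`. [cite: Constantin1986, §1 (1.7)-(1.10)] -/
theorem slice_word_le_energy_form {a b : EuclideanSpace ℝ (Fin 3) → EuclideanSpace ℝ (Fin 3)}
    {p₁ p₂ Q χ : EuclideanSpace ℝ (Fin 3) → ℝ} {c₀ : ℝ}
    (ha : ContDiff ℝ ∞ a) (hb : ContDiff ℝ ∞ b)
    (hdiva : ∀ x, ∑ j, pderiv j (fun y => a y j) x = 0) (hdivb : ∀ x, ∑ j, pderiv j (fun y => b y j) x = 0)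
    (hp₁ : ContDiff ℝ ∞ p₁) (hp₂ : ContDiff ℝ ∞ p₂) (hrQ : ∀ x, p₁ x - p₂ x = Q x + c₀)
    (hQ : MemLp Q 2 (volume : Measure (EuclideanSpace ℝ (Fin 3)))) {Qs : ℝ} (hQs0 : 0 ≤ Qs)
    (hQs : Real.sqrt (∫ x, Q x ^ 2) ≤ Qs)
    (hχ : ContDiff ℝ ∞ χ) (hχc : HasCompactSupport χ) (hχ0 : ∀ x, 0 ≤ χ x) (hχ1 : ∀ x, χ x ≤ 1)
    {k n : ℕ} (hk : 4 ≤ k) (hn : n ≤ k) (α : Fin n → Fin 3)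
    (hIall : ∀ m, Integrable (fun x => ∑ i, dnormSq m (fun z => a z i - b z i) x)
      (volume : Measure (EuclideanSpace ℝ (Fin 3))))
    {E : ℝ} (hE0 : 0 ≤ E) (hEle : ∀ m ≤ k, ∫ x, ∑ i, dnormSq m (fun z => a z i - b z i) x ≤ E)
    {Iw : ℝ} (hIw0 : 0 ≤ Iw) (hIw : ∀ m ≤ 2 * k + 1, ∫ x, ∑ i, dnormSq m (fun z => a z i - b z i) x ≤ Iw)
    {C : ℝ} (hC0 : 0 ≤ C)
    (hsup : ∀ c : ℕ, c + 2 ≤ k → ∀ (i : Fin 3) (x : EuclideanSpace ℝ (Fin 3)),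
      dnormSq c (fun z => a z i - b z i) x ≤ C * E)
    {IU : ℝ} (hIb : Integrable (fun x => ∑ i, dnormSq (n + 2) (fun y => b y i) x)
      (volume : Measure (EuclideanSpace ℝ (Fin 3))))
    (hIU : ∫ x, ∑ i, dnormSq (n + 2) (fun y => b y i) x ≤ IU)
    {ν Ba Bb Aχ R : ℝ} (hν : 0 ≤ ν) (hBa0 : 0 ≤ Ba) (hBa : ∀ x j, |a x j| ≤ Ba) (hBb0 : 0 ≤ Bb)
    (hBb : ∀ c, c ≤ n + 1 → ∀ i x, dnorm c (fun y => b y i) x ≤ Bb) (hAχ0 : 0 ≤ Aχ) (hR : 1 ≤ R)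
    (hAR1 : ∀ j x, |pderiv j χ x| ≤ Aχ / R)
    (hAR : ∀ c, 1 ≤ c → c ≤ n + 1 → ∀ x, dnorm c χ x ≤ Aχ / R) :
    ∑ i, ∫ x, χ x *
      ((ipderiv α (fun y => ν * ∑ j, pderiv j (pderiv j fun z => a z i) y - pderiv i p₁ y -
            ∑ j, a y j * pderiv j (fun z => a z i) y) x -
          ipderiv α (fun y => 0 * ∑ j, pderiv j (pderiv j fun z => b z i) y - pderiv i p₂ y -
            ∑ j, b y j * pderiv j (fun z => b z i) y) x) *
        ipderiv α (fun z => a z i - b z i) x) ≤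
      Aχ * (9 * Ba * Iw / 2 + 9 * ν * Iw + 2 ^ n * Qs * (3 * (n + 1) * Real.sqrt Iw)) / R +
        ν * (9 * Real.sqrt IU) * Real.sqrt E + 2 ^ n * 9 * Bb * (n + 1) ^ 2 * E +
        2 ^ n * (9 * n * (Real.sqrt C * (E * Real.sqrt E))) := by
  have hR0 : 0 < R := one_pos.trans_le hR
  have hAR0 : 0 ≤ Aχ / R := div_nonneg hAχ0 hR0.le
  set w : Fin 3 → EuclideanSpace ℝ (Fin 3) → ℝ := fun i z => a z i - b z i with hw_def
  have hw : ∀ i, ContDiff ℝ ∞ (w i) := fun i =>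
    (contDiff_comp_of_contDiff ha i).sub (contDiff_comp_of_contDiff hb i)
  have hEle' : ∀ m ≤ k, Integrable (fun x => ∑ i, dnormSq m (w i) x) ∧ ∫ x, ∑ i, dnormSq m (w i) x ≤ E :=
    fun m hm => ⟨hIall m, hEle m hm⟩
  -- the printed slice inequality
  have h := constantin_slice_word_pairing_le ha hb hdiva hdivb hp₁ hp₂ hrQ hQ hχ hχc hχ0 hχ1 α
    hIall hIb hν hBa0 hBa hBb0 hBb hAR0 hAR1 hAR
  rw [Fintype.card_fin] at h
  push_cast at h
  simp only [show ((3 : ℝ)) ^ 2 = 9 by norm_num] at h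
  -- level integrals in terms of `E` and `Iw`
  set L : ℕ → ℝ := fun m => ∫ x, ∑ i, dnormSq m (w i) x with hL
  have hL0 : ∀ m, 0 ≤ L m := fun m => integral_nonneg fun x => Finset.sum_nonneg fun i _ => dnormSq_nonneg _ _ _
  have hLE : ∀ m ≤ k, L m ≤ E := fun m hm => hEle m hm
  have hLI : ∀ m ≤ 2 * k + 1, L m ≤ Iw := fun m hm => hIw m hm
  have hsE : ∀ m ≤ k, Real.sqrt (L m) ≤ Real.sqrt E := fun m hm => Real.sqrt_le_sqrt (hLE m hm)
  have hsI : ∀ m ≤ 2 * k + 1, Real.sqrt (L m) ≤ Real.sqrt Iw := fun m hm => Real.sqrt_le_sqrt (hLI m hm)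
  -- the six terms
  have hT1 : 2⁻¹ * 9 * Ba * L n ≤ 9 * Ba * Iw / 2 := by
    have := hLI n (by omega)
    nlinarith
  have hT2 : ν * 9 * Real.sqrt (L n) * Real.sqrt (L (n + 1)) ≤ 9 * ν * Iw := by
    have h1 := hsI n (by omega)
    have h2 := hsI (n + 1) (by omega)
    calc ν * 9 * Real.sqrt (L n) * Real.sqrt (L (n + 1)) ≤ ν * 9 * Real.sqrt Iw * Real.sqrt Iw := by
          gcongr
      _ = 9 * ν * Iw := by rw [mul_assoc, Real.mul_self_sqrt hIw0]; ring
  have hT3 : 2 ^ n * Real.sqrt (∫ x, Q x ^ 2) *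
      Real.sqrt (∫ x, (∑ i, ∑ k' ∈ Finset.range (n + 1), dnorm (n - k') (ipderiv α (w i)) x) ^ 2) ≤
      2 ^ n * Qs * (3 * (n + 1) * Real.sqrt Iw) := by
    have hY := sqrt_integral_sq_sum_dnorm_ipderiv_le hw α hIall (fun m hm => hLI m (by omega))
    gcongr
  have hT4 : ν * 9 * Real.sqrt (∫ x, ∑ i, dnormSq (n + 2) (fun y => b y i) x) * Real.sqrt (L n) ≤
      ν * (9 * Real.sqrt IU) * Real.sqrt E := by
    have h1 := Real.sqrt_le_sqrt hIU
    have h2 := hsE n hn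
    calc ν * 9 * Real.sqrt (∫ x, ∑ i, dnormSq (n + 2) (fun y => b y i) x) * Real.sqrt (L n)
        ≤ ν * 9 * Real.sqrt IU * Real.sqrt E := by gcongr
      _ = ν * (9 * Real.sqrt IU) * Real.sqrt E := by ring
  have hT5 : 2 ^ n * 9 * Bb * (n + 1) * (∑ k' ∈ Finset.range (n + 1), Real.sqrt (L k')) * Real.sqrt (L n) ≤
      2 ^ n * 9 * Bb * (n + 1) ^ 2 * E := by
    have h1 : ∑ k' ∈ Finset.range (n + 1), Real.sqrt (L k') ≤ (n + 1) * Real.sqrt E := by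
      calc ∑ k' ∈ Finset.range (n + 1), Real.sqrt (L k') ≤ ∑ _k' ∈ Finset.range (n + 1), Real.sqrt E :=
            Finset.sum_le_sum fun k' hk' => hsE k' ((Nat.lt_succ_iff.1 (Finset.mem_range.1 hk')).trans hn)
        _ = (n + 1) * Real.sqrt E := by rw [Finset.sum_const, Finset.card_range, nsmul_eq_mul]; push_cast; ring
    have h2 := hsE n hn
    have hs0 : 0 ≤ ∑ k' ∈ Finset.range (n + 1), Real.sqrt (L k') := Finset.sum_nonneg fun _ _ => Real.sqrt_nonneg _
    calc 2 ^ n * 9 * Bb * (n + 1) * (∑ k' ∈ Finset.range (n + 1), Real.sqrt (L k')) * Real.sqrt (L n)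
        ≤ 2 ^ n * 9 * Bb * (n + 1) * ((n + 1) * Real.sqrt E) * Real.sqrt E := by gcongr
      _ = 2 ^ n * 9 * Bb * (n + 1) ^ 2 * E := by
          have : Real.sqrt E * Real.sqrt E = E := Real.mul_self_sqrt hE0
          calc 2 ^ n * 9 * Bb * (n + 1) * ((n + 1) * Real.sqrt E) * Real.sqrt E
              = 2 ^ n * 9 * Bb * (n + 1) ^ 2 * (Real.sqrt E * Real.sqrt E) := by ring
            _ = _ := by rw [this]
  have hT6 := trilinear_le_energy hw hk hn α hE0 hC0 hEle' hsup hχ0 hχ1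
  -- assemble
  have hsum : Aχ / R * (2⁻¹ * 9 * Ba * L n + ν * 9 * Real.sqrt (L n) * Real.sqrt (L (n + 1)) +
      2 ^ n * Real.sqrt (∫ x, Q x ^ 2) *
        Real.sqrt (∫ x, (∑ i, ∑ k' ∈ Finset.range (n + 1), dnorm (n - k') (ipderiv α (w i)) x) ^ 2)) ≤
      Aχ * (9 * Ba * Iw / 2 + 9 * ν * Iw + 2 ^ n * Qs * (3 * (n + 1) * Real.sqrt Iw)) / R := by
    calc _ ≤ Aχ / R * (9 * Ba * Iw / 2 + 9 * ν * Iw + 2 ^ n * Qs * (3 * (n + 1) * Real.sqrt Iw)) :=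
          mul_le_mul_of_nonneg_left (add_le_add (add_le_add hT1 hT2) hT3) hAR0
      _ = _ := by ring
  refine h.trans ?_
  simp only [hw_def, hL] at hsum hT4 hT5 hT6 ⊢
  linarith [hsum, hT4, hT5, hT6]

end Word

end Literature.Analysis.FluidPDE

end
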